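import Literature.Computability.AlgebraicComplexity.OrbitClosureProofs
import Literature.Computability.AlgebraicComplexity.CircuitGateSemantics
import Literature.Computability.AlgebraicComplexity.ArithCircuitProofs
import Literature.Computability.AlgebraicComplexity.ValiantClasses
import HarnessLib

/-!
# GCT I §6: the generic circuit form `H(Y)`, its universality, and Prop. 6.1 — PROOFS

Topic `Computability/AlgebraicComplexity`. Cell `val-lit`, row MS2001-A (K. Mulmuley, M. Sohoni,
*Geometric complexity theory I: an approach to the P vs. NP and related problems*, SIAM J. Comput.
31 (2001) 496–526), §6 "Arithmetic circuits", typed from the AUTHORS' VERSION (AV, 2001-04-23;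
text of record `HOME/bip/texts/MS2001-authorversion/`, locator grammar «AV p.N, all.txt Lnnnn» as
in `MS2001ClassVarieties.lean`). The rows «Prop 6.1» and «§6 H(Y)» of the typer table
`HOME/bip/CHECK-t01.md` were SKIPPED at typing time ("implicit constant `l = O(r²)`"); this file
types them with explicit constants and PROVES them. No definitions of notions (only the concrete
polynomial `H(Y)` and the bookkeeping of its universality), no named facts, no `sorry`.

## The source (AV p.28, all.txt L2008–2062)

> "The role of the determinant function in Section 4 would now be played by a certain function
> `H(Y)`, which would be complete for the class of polynomials having small circuit size. To
> define it, consider a generic arithmetic circuit of depth `k` and width `m`. It consists of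
> `k + 1` levels of nodes, numbered `0` to `k`, each level containing `m` nodes, except the root
> level zero, which contains a single output node. Each node in the level `i < k` is connected to
> every node in level `i + 1`. Each node `u` in the input level `k` is labeled with the variable
> `y_u`; the function computed by this node is defined to be `y_u`. The function `h(u)` computed
> by a node `u` in level `i < k` is defined to be `∑_{v,w} y^u_{v,w} h(v) h(w)`, where `v` and `w`
> range over nodes in level `i + 1` and each `y^u_{v,w}` is an indeterminate. Let `Y` be the
> vector of the variables `y_u`s at the input level `k` and the variables `y^u_{v,w}`s. Let `H(Y)`
> be the function computed at the root level zero. It is a homogeneous form in `Y` with total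
> degree exponential in `k`.
> Any arithmetic circuit of size `r` can be obtained from the generic circuit of depth `k ≤ r`
> and width `m ≤ r` by specializing the indeterminates `y^u_{v,w}` to some constants and the
> indeterminates `y_u`s at the input level to the input parameters or constants. Hence `H(Y)` is
> complete for the class of polynomials with small circuits. […] Let `V` be the space of
> homogeneous forms in `Y` with degree equal to that of `H(Y)`. Let `l = O(r²)` be the size of
> `Y` that corresponds to the generic circuit with depth and width `r`. We can define, as in
> Section 4, the function `φ` for embedding in `V` the forms of lower degree in the smaller
> variable vector `X` of dimension `n < m`: specifically identify `X` with some of the input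
> variables in `Y` and use some remaining variable as a homogenizing parameter. Let
> `G = SL_l(F)`. Then:
> **Proposition 6.1** If `f(X)` has an arithmetic circuit of size `r` then `f^φ(Y)` lies in the
> (projective) Zariski-closure `Δ[H(Y)]` of the `G`-orbit of `H(Y)` in `P(V)`, where `l = O(r²)`.
> *Proof:* The proof is similar to that of Proposition 4.1. The role of determinant in that proof
> is now played by `H(Y)`, which is complete for the class of functions with small circuits.

## Contents

* §1 `X_pow_mul_rename_mem_endOrbit_of_isProjection` — the padding step "as in Proposition 4.1"
  for an ARBITRARY form `g` in place of `det_m`: if a form `f` of degree `d` is a Valiant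
  projection (`IsProjection`) of a form `g` of degree `D ≥ d`, then `X_y^{D-d} · f(X_ι)` is a
  linear-substitution instance of `g` (`endOrbit`), for every placement `ι` of the variables of
  `f` among those of `g` and every variable `y` of `g` (homogenise the substituted constants
  with `X_y`, compare values where `x_y ≠ 0`, conclude by density; `F` an infinite field).
  Generalises the tree's `X_pow_mul_rename_mem_endOrbit_detPoly` (whose proof is followed).
* §2 `MS2001GenericCircuit.Var k m` (the index set of `Y`), `MS2001GenericCircuit.nodeVal`
  (the forms `h(u)`), `genericCircuitForm F k m = H(Y)`; homogeneity and the degrees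
  (`deg h(u) = 2^{j+1} - 1` at height `j` above the inputs, `deg H = 2^{k+1} - 1`) and the exact
  variable count `l = m + m² + (k-1) m³` (`MS2001GenericCircuit.card_var`).
* §3 UNIVERSALITY (the sentence "Any arithmetic circuit of size `r` can be obtained from the
  generic circuit … by specializing", AV p.28 L2037–2041), in the tree's model of arithmetic
  circuits (`ArithCircuit`, Bürgisser 2000 Def. 2.1: weighted-sum and product gates; fan-in two,
  the model of the tree's `complexity`): a fan-in-two circuit `P` with `s` gates on a finite
  variable type `σ` computes a PROJECTION of `H(Y)` for every depth `k ≥ s + 1` and every width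
  `m ≥ #σ + s + 1` (`MS2001GenericCircuit.isProjection_eval`; in the currency `complexity`:
  `isProjection_genericCircuitForm_of_complexity_le`).
* §4 **Prop. 6.1** PROVED (`MS2001_prop_6_1`): for a form `f` of degree `d` with
  `complexity f ≤ r`, every `k ≥ r + 1`, `m ≥ #σ + r + 1`, `d ≤ 2^{k+1} - 1`, every placement
  `ι : σ → Var k m` and every variable `y`, `X_y^{2^{k+1}-1-d} · f(X_ι) ∈ Δ[H(Y)]`
  (`orbitClosure`, the tree's `Δ[·]`), over every infinite field.

## Rendering, constants, deviations (disclosed)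

* LEVELS ↔ HEIGHTS. The print numbers levels `0` (root) to `k` (inputs); the Lean recursion runs
  by HEIGHT above the input level: `nodeVal j` is the vector of the `m` forms computed at height
  `j`, i.e. at the print's level `k - j` (`j = 0`: the inputs `y_u`; `1 ≤ j ≤ k - 1`: the internal
  levels), and `H(Y)` is the root, reading height `k - 1`. The variables `y^u_{v,w}` of the
  internal levels are indexed by `Fin (k-1) × Fin m × Fin m × Fin m` = (height − 1, `u`, `v`, `w`),
  those of the root by `Fin m × Fin m` = (`v`, `w`), the inputs by `Fin m`; `(v, w)` ranges over
  ORDERED pairs, as printed ("`v` and `w` range over nodes in level `i + 1`"). For `k = 0` (no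
  such object in print, where the root level `0` differs from the input level `k`) the definition
  returns the depth-one form `∑ y_{v,w} y_v y_w`; every degree statement carries `1 ≤ k`.
* DEGREES. Print (AV p.29 L2083–2091): "The total degree of `H(Y)` in the variables `y^u_{v,w}`
  that occur at level `i` is `d_i = 2^i`, and its total degree in the input variables `y_u`s is
  `d_{k+1} = 2^{k+1}`". With the levels numbered `0 … k` as on p.28 the block degrees are `2^i`
  at level `i ≤ k - 1` and `2^k` in the inputs, total `2^{k+1} - 1`; the print's `d_{k+1} = 2^{k+1}`
  is this count with the input level numbered `k + 1` — an index shift in print, immaterial. Typed: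
  total degree `2^{k+1} - 1` (`isHomogeneous_genericCircuitForm`); the block degrees are not used.
* SIZE OF `Y`. Print: "`l = O(r²)` … the generic circuit with depth and width `r`". As defined on
  p.28 (one indeterminate per node `u` of level `i < k` and per ordered pair `(v, w)` of level
  `i + 1`) the count is `l = m + m² + (k-1)·m³` (`card_var`), i.e. `Θ(r⁴)` at `k = m = r`. The
  statement is typed with the exact `l`; the discrepancy with the printed `O(r²)` is RECORDED here,
  not resolved (it is immaterial for the polynomial regime of §7).
* CIRCUIT MODEL AND CONSTANTS. Print: size `r` = number of nodes of the DAG INCLUDING the input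
  nodes (variables and constants), gates `+`/`×` (fan-in unspecified; two in the standard
  reading), "depth `k ≤ r` and width `m ≤ r`". Tree: `ArithCircuit F σ` with `s = P.size` GATES
  (inputs not counted), weighted-sum gates `∑ cᵢ uᵢ` of any fan-in and product gates, hypothesis
  `IsFanInTwo` (the model of `complexity`; only the product gates need it here). Our embedding
  keeps, at every internal level, a node computing `1`, a node per variable and a node per gate
  (gate `t` is computed at height `t + 1` and copied upwards as `g · 1`), so it uses depth
  `k = s + 1` and width `m = #σ + s + 1`; in the print's count `r ≥ #σ + s` this is `k ≤ r + 1`,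
  `m ≤ r + 1` (the extra `1` is our constant node; the print folds constants into input nodes of
  the given circuit). Both parameters are free above these thresholds (larger generic circuits
  also specialise to `P`).
* `f^φ`. As in the tree's `MS2001_prop_4_1`: `f^φ(Y) = X_y^{D-d} · f(X_ι)` for ANY placement `ι` of
  the variables of `f` in `Y` and ANY variable `y` (print: `X` among the input variables, `y`
  another input variable; the statement holds for every `ι`, `y`). Field: any infinite field
  (print: algebraically closed). `G`-orbit closure: the tree's `orbitClosure` is the affine cone
  over the print's projective `Δ[·]` for the `GL_l`-action, which has the same closed orbit
  closures as `SL_l` on forms up to scalars — the convention of every MS2001 file of the tree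
  (`MS2001ClassVarieties.lean`, module docstring).

Honest framing: literature typing of a universality construction; Prop. 6.1 reduces circuit
lower bounds to an orbit-closure problem exactly as Prop. 4.1 does for formulas; nothing here is
progress on any separation (`VP ≠ VNP` is NOT proved), and the §7 conjectures built on `H(Y)`
(Conj. 7.5–7.11) are open problems, not Literature.

## References

* [MulmuleySohoniSIAM2001] K. Mulmuley, M. Sohoni, *Geometric complexity theory I*, SIAM J.
  Comput. 31 (2001) 496–526, §6 (AV pp.27–29, all.txt L1995–2140), Prop. 6.1 (AV p.28, L2057).
* [Burgisser2000] P. Bürgisser, *Completeness and Reduction in Algebraic Complexity Theory*,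
  Springer 2000, Def. 2.1 (the tree's `ArithCircuit`, `complexity`), Def. 2.6 (`IsProjection`).
-/

noncomputable section

open MvPolynomial

namespace Literature.Computability.AlgebraicComplexity

universe u v

/-! ## §1. Padding a projection of a form into its endomorphism orbit ("as in Proposition 4.1") -/

section Padding

variable {F : Type u} [Field F]

/-- Evaluating a substitution: `(g ∘ a)(x) = g(a(x))` (twin of the tree's private copies). [folklore] -/
private theorem eval_aeval_eq {ρ τ : Type*} (x : τ → F) (a : ρ → MvPolynomial τ F)
    (g : MvPolynomial ρ F) : eval x (aeval a g) = eval (fun v => eval x (a v)) g := by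
  rw [show aeval a g = bind₁ a g from rfl, eval, eval₂Hom_bind₁]
  rfl

/-- **The padding step of GCT I Props. 4.1 / 6.1 for an arbitrary form.** Let `g` be a form of
degree `D` in the variables `ρ` and let `f`, a form of degree `d ≤ D` in the variables `τ`, be a
PROJECTION of `g` (`f = g(a)` with every `a_v` a variable of `f` or a constant; Valiant). Then for
every placement `ι : τ → ρ` and every variable `y`, the padded form `X_y^{D-d} · f(X_ι)` is a
linear-substitution instance of `g`, i.e. lies in `End(F^ρ) · g`: substitute `a_v = x_t ↦ X_{ι t}`,
`a_v = c ↦ c · X_y`; the result agrees with `X_y^{D-d} f(X_ι)` wherever `x_y ≠ 0` (homogeneity of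
`g` and of `f`), hence everywhere (`F` infinite). This is "eq. (3)" of the printed proof of
Prop. 4.1 (AV p.13) with `det` replaced by any form, which is all that the proof of Prop. 6.1
("similar to that of Proposition 4.1", AV p.28 L2061) uses; the tree's
`X_pow_mul_rename_mem_endOrbit_detPoly` is the case `g = det_m`.
[cite: MulmuleySohoniSIAM2001, Prop. 6.1 (proof, AV p.28 L2061) and Prop. 4.1 (proof, AV p.13)] -/
theorem X_pow_mul_rename_mem_endOrbit_of_isProjection [Infinite F] {ρ : Type*} [Fintype ρ]
    [DecidableEq ρ] {τ : Type*} [Fintype τ] {g : MvPolynomial ρ F} {D : ℕ}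
    (hg : g.IsHomogeneous D) {f : MvPolynomial τ F} {d : ℕ} (hf : f.IsHomogeneous d)
    (hdD : d ≤ D) (hfg : IsProjection f g) (ι : τ → ρ) (y : ρ) :
    X y ^ (D - d) * rename ι f ∈ endOrbit ρ F g := by
  classical
  obtain ⟨a, ha, rfl⟩ := hfg
  have hadeg : ∀ v, (a v).totalDegree ≤ 1 := by
    intro v
    rcases ha v with ⟨j, hj⟩ | ⟨c, hc⟩
    · rw [hj]; exact (totalDegree_X j).le
    · rw [hc, totalDegree_C]; exact Nat.zero_le _
  -- the homogenising substitution matrix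
  set M : Matrix ρ ρ F := fun p v =>
    (if p = y then coeff 0 (a v) else 0) +
      ∑ t, if p = ι t then coeff (Finsupp.single t 1) (a v) else 0 with hM
  refine ⟨M, ?_⟩
  -- values of the substituted variables where `x y ≠ 0`
  have hentry : ∀ (x : ρ → F), x y ≠ 0 → ∀ v : ρ,
      eval x (∑ p, M p v • (X p : MvPolynomial ρ F)) =
        x y * eval (fun t => x (ι t) / x y) (a v) := by
    intro x hx v
    rw [map_sum, eval_eq_of_totalDegree_le_one (hadeg v)]
    simp only [smul_eval, eval_X, hM, add_mul, Finset.sum_add_distrib, Finset.sum_mul, ite_mul,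
      zero_mul]
    rw [Finset.sum_comm]
    simp only [mul_add, Finset.mul_sum]
    congr 1
    · rw [Finset.sum_ite_eq' Finset.univ y, if_pos (Finset.mem_univ _)]
      ring
    · refine Finset.sum_congr rfl fun t _ => ?_
      rw [Finset.sum_ite_eq' Finset.univ (ι t), if_pos (Finset.mem_univ _)]
      field_simp
  -- values of the substituted form where `x y ≠ 0`
  have hval : ∀ (x : ρ → F), x y ≠ 0 →
      eval x (linSubst ρ F M g) = x y ^ (D - d) * eval (x ∘ ι) (aeval a g) := by
    intro x hx
    have h1 : linSubst ρ F M g = aeval (fun v => ∑ p, M p v • (X p : MvPolynomial ρ F)) g := rfl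
    rw [h1, eval_aeval_eq]
    have h2 : (fun v => eval x (∑ p, M p v • (X p : MvPolynomial ρ F))) =
        x y • fun v => eval (fun t => x (ι t) / x y) (a v) := by
      funext v
      rw [hentry x hx v]
      rfl
    rw [h2, eval_smul_of_isHomogeneous hg]
    have h3 : (fun t => x (ι t) / x y) = (x y)⁻¹ • (x ∘ ι) := by
      funext t
      simp [div_eq_inv_mul]
    have h4 : eval (fun v => eval (fun t => x (ι t) / x y) (a v)) g =
        ((x y)⁻¹) ^ d * eval (x ∘ ι) (aeval a g) := by
      rw [← eval_aeval_eq (fun t => x (ι t) / x y) a g, h3, eval_smul_of_isHomogeneous hf]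
    rw [h4, ← mul_assoc]
    congr 1
    rw [← Nat.sub_add_cancel hdD, pow_add, Nat.add_sub_cancel, mul_assoc, ← mul_pow,
      mul_inv_cancel₀ hx, one_pow, mul_one]
  -- the two polynomials agree where `x y ≠ 0`, hence everywhere
  have hprod : (linSubst ρ F M g - X y ^ (D - d) * rename ι (aeval a g)) * X y = 0 := by
    apply MvPolynomial.funext
    intro x
    rw [map_mul, map_sub, map_zero, eval_X]
    by_cases hx : x y = 0
    · rw [hx, mul_zero]
    · rw [hval x hx, map_mul, map_pow, eval_X, eval_rename, sub_self, zero_mul]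
  have hX : (X y : MvPolynomial ρ F) ≠ 0 := X_ne_zero y
  exact sub_eq_zero.mp ((mul_eq_zero.mp hprod).resolve_right hX)

end Padding

/-! ## §2. The generic circuit of depth `k` and width `m`, and the form `H(Y)` -/

namespace MS2001GenericCircuit

/-- The index set of the variable vector `Y` of the generic circuit of depth `k` and width `m`
(AV p.28 L2010–2028): `Sum.inl u` = the input variable `y_u` of the input node `u` (level `k`);
`Sum.inr (Sum.inl (v, w))` = the variable `y^{root}_{v,w}` of the single root node (level `0`),
`v, w` nodes of level `1`; `Sum.inr (Sum.inr (j, u, v, w))` = the variable `y^u_{v,w}` of the node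
`u` at HEIGHT `j + 1` above the inputs (= the print's level `k - 1 - j`, `j < k - 1`), `v, w`
nodes one level below. [cite: MulmuleySohoniSIAM2001, §6 (AV p.28, all.txt L2010–2028)] -/
abbrev Var (k m : ℕ) : Type := Fin m ⊕ (Fin m × Fin m) ⊕ (Fin (k - 1) × Fin m × Fin m × Fin m)

/-- The size `l` of `Y`: `m` input variables, `m²` variables of the root, `m³` variables per
internal level, `k - 1` internal levels: `l = m + m² + (k-1) m³` (print, AV p.28 L2050: "Let
`l = O(r²)` be the size of `Y` that corresponds to the generic circuit with depth and width `r`";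
the count as defined is `Θ(r⁴)`, recorded in the module docstring).
[cite: MulmuleySohoniSIAM2001, §6 (AV p.28, all.txt L2050)] -/
theorem card_var (k m : ℕ) : Fintype.card (Var k m) = m + m ^ 2 + (k - 1) * m ^ 3 := by
  simp only [Var, Fintype.card_sum, Fintype.card_prod, Fintype.card_fin]
  ring

end MS2001GenericCircuit

open MS2001GenericCircuit

section GenericCircuit

variable (F : Type u) [CommSemiring F] (k m : ℕ)

namespace MS2001GenericCircuit

/-- The forms computed by the nodes of the generic circuit, by HEIGHT above the input level
(AV p.28 L2019–2025): at height `0` (the input level `k`) the node `u` computes `y_u`; at height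
`j + 1 ≤ k - 1` (the print's level `k - 1 - j`) the node `u` computes
`h(u) = ∑_{v,w} y^u_{v,w} h(v) h(w)` over the ordered pairs `(v, w)` of nodes at height `j`.
Heights `≥ k` are junk (`0`). [cite: MulmuleySohoniSIAM2001, §6 (AV p.28, all.txt L2019–2025)] -/
def nodeVal : ℕ → Fin m → MvPolynomial (Var k m) F
  | 0, u => X (Sum.inl u)
  | j + 1, u =>
    if h : j < k - 1 then
      ∑ v : Fin m, ∑ w : Fin m,
        X (Sum.inr (Sum.inr (⟨j, h⟩, u, v, w))) * (nodeVal j v * nodeVal j w)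
    else 0

end MS2001GenericCircuit

/-- **The generic circuit form `H(Y)`** of depth `k` and width `m` (Mulmuley–Sohoni 2001, §6,
AV p.28 L2026–2028: "Let `H(Y)` be the function computed at the root level zero"): the root reads
the `m` nodes of level `1` (height `k - 1`), `H(Y) = ∑_{v,w} y^{root}_{v,w} h(v) h(w)`. A form of
degree `2^{k+1} - 1` in `l = m + m² + (k-1) m³` variables (`isHomogeneous_genericCircuitForm`,
`MS2001GenericCircuit.card_var`). The object of GCT I's circuit-size programme (Props. 6.1, 6.2,
§7, Conjs. 7.5–7.11 — the conjectures are open problems and are NOT typed).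
[cite: MulmuleySohoniSIAM2001, §6 (AV p.28, all.txt L2010–2031)] -/
def genericCircuitForm : MvPolynomial (Var k m) F :=
  ∑ v : Fin m, ∑ w : Fin m,
    X (Sum.inr (Sum.inl (v, w))) * (nodeVal F k m (k - 1) v * nodeVal F k m (k - 1) w)

namespace MS2001GenericCircuit

/-- Unfolding the input level: `h(u) = y_u`. [cite: MulmuleySohoniSIAM2001, §6 (AV p.28, all.txt L2019)] -/
@[simp]
theorem nodeVal_zero (u : Fin m) : nodeVal F k m 0 u = X (Sum.inl u) := rfl

/-- Unfolding an internal level: `h(u) = ∑_{v,w} y^u_{v,w} h(v) h(w)`.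
[cite: MulmuleySohoniSIAM2001, §6 (AV p.28, all.txt L2021–2025)] -/
theorem nodeVal_succ {j : ℕ} (hj : j < k - 1) (u : Fin m) :
    nodeVal F k m (j + 1) u =
      ∑ v : Fin m, ∑ w : Fin m,
        X (Sum.inr (Sum.inr (⟨j, hj⟩, u, v, w))) * (nodeVal F k m j v * nodeVal F k m j w) := by
  rw [nodeVal, dif_pos hj]

/-- **Degrees of the nodes**: the node forms at height `j ≤ k - 1` are homogeneous of degree
`2^{j+1} - 1` (`1` at the inputs, and `deg h(u) = 1 + 2 · deg h(v)` one level up; AV p.28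
L2028–2029 "a homogeneous form in `Y` with total degree exponential in `k`").
[cite: MulmuleySohoniSIAM2001, §6 (AV p.28, all.txt L2028)] -/
theorem isHomogeneous_nodeVal : ∀ (j : ℕ), j ≤ k - 1 → ∀ u : Fin m,
    (nodeVal F k m j u).IsHomogeneous (2 ^ (j + 1) - 1)
  | 0, _, u => by simpa using isHomogeneous_X F (Sum.inl u : Var k m)
  | j + 1, hj, u => by
    have hj' : j < k - 1 := by omega
    rw [nodeVal_succ F k m hj']
    have hdeg : 2 ^ (j + 1 + 1) - 1 = 1 + ((2 ^ (j + 1) - 1) + (2 ^ (j + 1) - 1)) := by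
      have h1 : 1 ≤ 2 ^ (j + 1) := Nat.one_le_two_pow
      rw [pow_succ]
      omega
    rw [hdeg]
    refine IsHomogeneous.sum _ _ _ fun v _ => IsHomogeneous.sum _ _ _ fun w _ => ?_
    exact (isHomogeneous_X F _).mul
      ((isHomogeneous_nodeVal j hj'.le v).mul (isHomogeneous_nodeVal j hj'.le w))

end MS2001GenericCircuit

/-- **`H(Y)` is a form of degree `2^{k+1} - 1`** (for `k ≥ 1`; AV p.28 L2028–2029, p.29
L2083–2091: block degrees `2^i` at level `i < k` and `2^k` in the inputs with the levels numbered
`0 … k`; the print's "`d_{k+1} = 2^{k+1}`" numbers the input level `k + 1`).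
[cite: MulmuleySohoniSIAM2001, §6 (AV p.28 L2028; p.29 L2083–2091)] -/
theorem isHomogeneous_genericCircuitForm (hk : 1 ≤ k) :
    (genericCircuitForm F k m).IsHomogeneous (2 ^ (k + 1) - 1) := by
  have hdeg : 2 ^ (k + 1) - 1 = 1 + ((2 ^ (k - 1 + 1) - 1) + (2 ^ (k - 1 + 1) - 1)) := by
    rw [Nat.sub_add_cancel hk, pow_succ]
    have h1 : 1 ≤ 2 ^ k := Nat.one_le_two_pow
    omega
  rw [genericCircuitForm, hdeg]
  refine IsHomogeneous.sum _ _ _ fun v _ => IsHomogeneous.sum _ _ _ fun w _ => ?_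
  exact (isHomogeneous_X F _).mul
    ((isHomogeneous_nodeVal F k m (k - 1) le_rfl v).mul (isHomogeneous_nodeVal F k m (k - 1) le_rfl w))

end GenericCircuit

/-! ## §3. Universality: every fan-in-two circuit is a specialisation of the generic circuit -/

namespace MS2001GenericCircuit

/-! ### Coefficient tables and their evaluation against node values -/

section Tables

variable {F : Type u} [CommSemiring F] {σ : Type v}

/-- The indicator coefficient table of the ordered pair of nodes with codes `(a, b)`.
[cite: MulmuleySohoniSIAM2001, §6 (AV p.28, all.txt L2037–2041)] -/
def pairInd {m : ℕ} (a b : ℕ) (v w : Fin m) : F := if (v : ℕ) = a ∧ (w : ℕ) = b then 1 else 0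

/-- The bilinear pairing of a coefficient table against a vector of node values:
`∑_{v,w} c_{v,w} V_v V_w` — the specialised value of a node `∑ y^u_{v,w} h(v) h(w)`.
[cite: MulmuleySohoniSIAM2001, §6 (AV p.28, all.txt L2021–2025)] -/
def pairEval {m : ℕ} (c : Fin m → Fin m → F) (V : Fin m → MvPolynomial σ F) : MvPolynomial σ F :=
  ∑ v : Fin m, ∑ w : Fin m, C (c v w) * (V v * V w)

variable {m : ℕ} (V : Fin m → MvPolynomial σ F)

/-- The zero table evaluates to `0`. [folklore] -/
private theorem pairEval_zero : pairEval (0 : Fin m → Fin m → F) V = 0 := by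
  simp [pairEval]

/-- Additivity in the table. [folklore] -/
private theorem pairEval_add (c₁ c₂ : Fin m → Fin m → F) :
    pairEval (c₁ + c₂) V = pairEval c₁ V + pairEval c₂ V := by
  simp [pairEval, Finset.sum_add_distrib, add_mul]

/-- Additivity over a list of tables. [folklore] -/
private theorem pairEval_list_sum (l : List (Fin m → Fin m → F)) :
    pairEval l.sum V = (l.map fun c => pairEval c V).sum := by
  induction l with
  | nil => simp [pairEval_zero]
  | cons c l ih => rw [List.sum_cons, pairEval_add, ih, List.map_cons, List.sum_cons]

/-- Homogeneity in the table. [folklore] -/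
private theorem pairEval_smul (r : F) (c : Fin m → Fin m → F) :
    pairEval (r • c) V = C r * pairEval c V := by
  simp [pairEval, Finset.mul_sum, mul_assoc]

/-- The indicator table of `(a, b)` evaluates to `V_a V_b`. [folklore] -/
private theorem pairEval_pairInd {a b : ℕ} (ha : a < m) (hb : b < m) :
    pairEval (pairInd a b) V = V ⟨a, ha⟩ * V ⟨b, hb⟩ := by
  have hva : ∀ v : Fin m, v ≠ ⟨a, ha⟩ → (v : ℕ) ≠ a := fun v hv h => hv (Fin.ext h)
  have hwb : ∀ w : Fin m, w ≠ ⟨b, hb⟩ → (w : ℕ) ≠ b := fun w hw h => hw (Fin.ext h)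
  unfold pairEval
  rw [Finset.sum_eq_single_of_mem (⟨a, ha⟩ : Fin m) (Finset.mem_univ _) ?_]
  · rw [Finset.sum_eq_single_of_mem (⟨b, hb⟩ : Fin m) (Finset.mem_univ _) ?_]
    · simp [pairInd]
    · intro w _ hw
      simp [pairInd, hwb w hw]
  · intro v _ hv
    refine Finset.sum_eq_zero fun w _ => ?_
    simp [pairInd, hva v hv]

end Tables

/-! ### The embedding data: node codes, roles, intended values -/

section Codes

variable (σ : Type v) [Fintype σ]

/-- The rôle of a node of the generic circuit in the embedding of a given circuit with `s` gates
on the variables `σ` (our layout for AV p.28 L2037–2041 "by specializing"): node `0` of every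
level computes the constant `1`, nodes `1, …, #σ` the variables, nodes `#σ + 1, …, #σ + s` the
gates, the remaining nodes `0`. [cite: MulmuleySohoniSIAM2001, §6 (AV p.28, all.txt L2037–2041)] -/
inductive Role (σ : Type v) : Type v
  /-- the constant-`1` node -/
  | one : Role σ
  /-- the node carrying the variable `x` -/
  | var (x : σ) : Role σ
  /-- the node carrying gate number `t` -/
  | gate (t : ℕ) : Role σ
  /-- an unused node -/
  | none : Role σ

/-- Decoding the rôle of the node with code (position in its level) `u`, for a circuit with `s`
gates. [cite: MulmuleySohoniSIAM2001, §6 (AV p.28, all.txt L2037–2041)] -/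
def role (s u : ℕ) : Role σ :=
  if u = 0 then .one
  else if h : u - 1 < Fintype.card σ then .var ((Fintype.equivFin σ).symm ⟨u - 1, h⟩)
  else if u - 1 - Fintype.card σ < s then .gate (u - 1 - Fintype.card σ)
  else .none

/-- Code of the constant-`1` node. [cite: MulmuleySohoniSIAM2001, §6 (AV p.28, all.txt L2037–2041)] -/
def oneCode : ℕ := 0

/-- Code of the node of the variable `x`. [cite: MulmuleySohoniSIAM2001, §6 (AV p.28, all.txt L2037–2041)] -/
def varCode (x : σ) : ℕ := 1 + (Fintype.equivFin σ x : ℕ)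

/-- Code of the node of gate number `t`. [cite: MulmuleySohoniSIAM2001, §6 (AV p.28, all.txt L2037–2041)] -/
def gateCode (t : ℕ) : ℕ := 1 + Fintype.card σ + t

variable {σ}

/-- Node `0` is the constant node. [folklore] -/
private theorem role_oneCode (s : ℕ) : role σ s oneCode = .one := by
  simp [role, oneCode]

/-- Node `varCode x` is the node of `x`. [folklore] -/
private theorem role_varCode (s : ℕ) (x : σ) : role σ s (varCode σ x) = .var x := by
  have h1 : varCode σ x ≠ 0 := by rw [varCode]; omega
  have h3 : varCode σ x - 1 < Fintype.card σ := by
    have := (Fintype.equivFin σ x).2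
    rw [varCode]; omega
  rw [role, if_neg h1, dif_pos h3]
  congr 1
  rw [Equiv.symm_apply_eq]
  exact Fin.ext (by simp [varCode])

/-- Node `gateCode t` is the node of gate `t` (`t < s`). [folklore] -/
private theorem role_gateCode {s t : ℕ} (ht : t < s) : role σ s (gateCode σ t) = .gate t := by
  have h1 : gateCode σ t ≠ 0 := by rw [gateCode]; omega
  have h2 : ¬ gateCode σ t - 1 < Fintype.card σ := by rw [gateCode]; omega
  have h3 : gateCode σ t - 1 - Fintype.card σ = t := by rw [gateCode]; omega
  rw [role, if_neg h1, dif_neg h2, h3, if_pos ht]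

/-- Only gates `t < s` have nodes. [folklore] -/
private theorem lt_of_role_eq_gate {s u t : ℕ} (h : role σ s u = .gate t) : t < s := by
  by_cases h0 : u = 0
  · simp [role, h0] at h
  · by_cases h1 : u - 1 < Fintype.card σ
    · simp [role, h0, h1] at h
    · by_cases h2 : u - 1 - Fintype.card σ < s
      · simp only [role, h0, h1, h2, if_false, dif_neg, not_false_eq_true, if_true,
          Role.gate.injEq] at h
        omega
      · simp [role, h0, h1, h2] at h

/-- The constant node exists as soon as `m ≥ 1 + #σ + s`. [folklore] -/
private theorem oneCode_lt {s m : ℕ} (hm : 1 + Fintype.card σ + s ≤ m) : oneCode < m := by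
  rw [oneCode]; omega

/-- The variable nodes exist as soon as `m ≥ 1 + #σ + s`. [folklore] -/
private theorem varCode_lt {s m : ℕ} (hm : 1 + Fintype.card σ + s ≤ m) (x : σ) : varCode σ x < m := by
  have := (Fintype.equivFin σ x).2
  rw [varCode]; omega

/-- The gate nodes exist as soon as `m ≥ 1 + #σ + s`. [folklore] -/
private theorem gateCode_lt {s m : ℕ} (hm : 1 + Fintype.card σ + s ≤ m) {t : ℕ} (ht : t < s) :
    gateCode σ t < m := by
  rw [gateCode]; omega

end Codes

section Embedding

variable {F : Type u} [CommSemiring F] {σ : Type v} [Fintype σ]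

/-- The scalar attached to an operand read at gate index `i` (junk references `gate t`, `t ≥ i`,
read `0`, as in the tree's `ArithCircuit.opVal`). [cite: Burgisser2000, Def. 2.1] -/
def opCoef (i : ℕ) : ArithCircuit.Operand F σ → F
  | .var _ => 1
  | .const c => c
  | .gate t => if t < i then 1 else 0

/-- The node code attached to an operand read at gate index `i`. [cite: Burgisser2000, Def. 2.1] -/
def opCode (i : ℕ) : ArithCircuit.Operand F σ → ℕ
  | .var x => varCode σ x
  | .const _ => oneCode
  | .gate t => if t < i then gateCode σ t else oneCode

/-- The coefficient table `(y^u_{v,w})_{v,w}` specialising a node to `c · (o · 1)` for an operand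
`o` with weight `c`. [cite: MulmuleySohoniSIAM2001, §6 (AV p.28, all.txt L2037–2041)] -/
def opTable {m : ℕ} (i : ℕ) (c : F) (o : ArithCircuit.Operand F σ) : Fin m → Fin m → F :=
  (c * opCoef i o) • pairInd (opCode i o) oneCode

/-- The coefficient table specialising a node to a PRODUCT gate with operand list `args` (fan-in
`≤ 2`; longer lists are sent to `0`): `1 · 1`, `o₁ · 1`, `o₁ · o₂`.
[cite: MulmuleySohoniSIAM2001, §6 (AV p.28, all.txt L2037–2041)] -/
def prodCoef {m : ℕ} (i : ℕ) : List (ArithCircuit.Operand F σ) → Fin m → Fin m → F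
  | [] => pairInd oneCode oneCode
  | [o₁] => opCoef i o₁ • pairInd (opCode i o₁) oneCode
  | [o₁, o₂] => (opCoef i o₁ * opCoef i o₂) • pairInd (opCode i o₁) (opCode i o₂)
  | _ :: _ :: _ :: _ => 0

/-- The coefficient table specialising a node to gate `g` read at index `i`: a weighted sum
`∑ c_a o_a` becomes `∑ c_a · (o_a · 1)`, a product as in `prodCoef`.
[cite: MulmuleySohoniSIAM2001, §6 (AV p.28, all.txt L2037–2041)] -/
def gateCoef {m : ℕ} (i : ℕ) : ArithCircuit.Gate F σ → Fin m → Fin m → F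
  | .sum args => (args.map fun a => opTable i a.1 a.2).sum
  | .prod args => prodCoef i args

variable (P : ArithCircuit F σ)

/-- The INTENDED value of the node with code `u` at height `j`: `1`, the variable `x`, the value
of gate `t` if it has been computed by height `j` (gate `t` is computed at height `t + 1`), else
`0`. [cite: MulmuleySohoniSIAM2001, §6 (AV p.28, all.txt L2037–2041)] -/
def value (j u : ℕ) : MvPolynomial σ F :=
  match role σ P.size u with
  | .one => 1
  | .var x => X x
  | .gate t => if t + 1 ≤ j then P.gateVal t else 0
  | .none => 0

/-- The specialisation of the input variable `y_u`: `1`, the variable `x`, or `0`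
("the indeterminates `y_u`s at the input level to the input parameters or constants").
[cite: MulmuleySohoniSIAM2001, §6 (AV p.28, all.txt L2039–2040)] -/
def inputSubst (u : ℕ) : MvPolynomial σ F :=
  match role σ P.size u with
  | .one => 1
  | .var x => X x
  | .gate _ => 0
  | .none => 0

/-- The coefficient table of the node `u` at height `j + 1` (children at height `j`): the
constant node copies `1 · 1`, a variable node copies `x · 1`, the node of gate `t < j` copies
`g_t · 1`, the node of gate `j` COMPUTES gate `j` from the nodes at height `j`, all other nodes
are zeroed. [cite: MulmuleySohoniSIAM2001, §6 (AV p.28, all.txt L2037–2041)] -/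
def innerCoef {m : ℕ} (j : ℕ) (u : ℕ) : Fin m → Fin m → F :=
  match role σ P.size u with
  | .one => pairInd oneCode oneCode
  | .var x => pairInd (varCode σ x) oneCode
  | .gate t =>
    if t < j then pairInd (gateCode σ t) oneCode
    else if t = j then
      (match P.gates[t]? with
        | some g => gateCoef t g
        | none => 0)
    else 0
  | .none => 0

/-- The coefficient table of the root: it copies the output operand (`out · 1`).
[cite: MulmuleySohoniSIAM2001, §6 (AV p.28, all.txt L2037–2041)] -/
def rootCoef {m : ℕ} : Fin m → Fin m → F :=
  opCoef P.size P.output • pairInd (opCode P.size P.output) oneCode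

/-- **The specialisation** of the variables `Y` of the generic circuit of depth `k` and width `m`
realising the circuit `P` ("specializing the indeterminates `y^u_{v,w}` to some constants and the
indeterminates `y_u`s at the input level to the input parameters or constants", AV p.28
L2038–2040). [cite: MulmuleySohoniSIAM2001, §6 (AV p.28, all.txt L2037–2041)] -/
def subst (k m : ℕ) : Var k m → MvPolynomial σ F
  | Sum.inl u => inputSubst P u
  | Sum.inr (Sum.inl (v, w)) => C (rootCoef P v w)
  | Sum.inr (Sum.inr (j, u, v, w)) => C (innerCoef P j u v w)

/-- Every specialised value is a variable or a constant (so `subst` is a Valiant projection).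
[cite: Burgisser2000, Def. 2.6] -/
theorem subst_isVarOrConst (k m : ℕ) (i : Var k m) :
    (∃ x, subst P k m i = X x) ∨ ∃ c, subst P k m i = C c := by
  rcases i with u | ⟨⟨v, w⟩ | ⟨j, u, v, w⟩⟩
  · cases hr : role σ P.size (u : ℕ) with
    | one => exact Or.inr ⟨1, by simp [subst, inputSubst, hr]⟩
    | var x => exact Or.inl ⟨x, by simp [subst, inputSubst, hr]⟩
    | gate t => exact Or.inr ⟨0, by simp [subst, inputSubst, hr]⟩
    | none => exact Or.inr ⟨0, by simp [subst, inputSubst, hr]⟩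
  · exact Or.inr ⟨rootCoef P v w, rfl⟩
  · exact Or.inr ⟨innerCoef P j u v w, rfl⟩

/-! ### The intended values are the specialised values -/

variable {P}

/-- The constant node has value `1`. [folklore] -/
private theorem value_oneCode (j : ℕ) : value P j oneCode = 1 := by
  simp [value, role_oneCode]

/-- A variable node has value its variable. [folklore] -/
private theorem value_varCode (j : ℕ) (x : σ) : value P j (varCode σ x) = X x := by
  simp [value, role_varCode]

/-- A gate node has value its gate once computed. [folklore] -/
private theorem value_gateCode {j t : ℕ} (ht : t < P.size) :
    value P j (gateCode σ t) = if t + 1 ≤ j then P.gateVal t else 0 := by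
  simp [value, role_gateCode ht]

variable {m : ℕ}

omit [CommSemiring F] in
/-- Operand nodes exist as soon as `m ≥ 1 + #σ + s`. [folklore] -/
private theorem opCode_lt (hm : 1 + Fintype.card σ + P.size ≤ m) {i : ℕ} (hi : i ≤ P.size)
    (o : ArithCircuit.Operand F σ) : opCode i o < m := by
  cases o with
  | var x => exact varCode_lt hm x
  | const c => exact oneCode_lt hm
  | gate t =>
    simp only [opCode]
    split_ifs with h
    · exact gateCode_lt hm (by omega)
    · exact oneCode_lt hm

/-- **An operand is read correctly**: at every height `j ≥ i`, the node of an operand read at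
gate index `i ≤ s`, weighted by its scalar, has the value `opVal P i` of that operand.
[cite: Burgisser2000, Def. 2.1] -/
theorem opCoef_mul_value {i j : ℕ} (hij : i ≤ j) (hi : i ≤ P.size)
    (o : ArithCircuit.Operand F σ) :
    C (opCoef i o) * value P j (opCode i o) = P.opVal i o := by
  cases o with
  | var x => simp [opCoef, opCode, value_varCode]
  | const c => simp [opCoef, opCode, value_oneCode]
  | gate t =>
    by_cases ht : t < i
    · have hts : t < P.size := by omega
      have htj : t + 1 ≤ j := by omega
      simp [opCoef, opCode, ht, value_gateCode hts, htj]
    · simp [opCoef, opCode, ht, value_oneCode]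

/-- An operand node, weighted, evaluates to `c • opVal`. [cite: Burgisser2000, Def. 2.1] -/
theorem pairEval_opTable (hm : 1 + Fintype.card σ + P.size ≤ m) {i j : ℕ} (hij : i ≤ j)
    (hi : i ≤ P.size) (c : F) (o : ArithCircuit.Operand F σ) :
    pairEval (opTable (m := m) i c o) (fun v => value P j v) = c • P.opVal i o := by
  rw [opTable, pairEval_smul, pairEval_pairInd _ (opCode_lt hm hi o) (oneCode_lt hm),
    value_oneCode, mul_one, map_mul, mul_assoc, opCoef_mul_value hij hi, smul_eq_C_mul]

/-- **A gate node computes its gate.** If gate `i` of `P` is `g`, of fan-in `≤ 2`, then the node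
specialised by `gateCoef i g`, reading the intended values at any height `j ≥ i`, computes
`gateVal P i`. [cite: MulmuleySohoniSIAM2001, §6 (AV p.28, all.txt L2037–2041)] -/
theorem pairEval_gateCoef (hm : 1 + Fintype.card σ + P.size ≤ m) {i j : ℕ} (hij : i ≤ j)
    {g : ArithCircuit.Gate F σ} (hg : P.gates[i]? = some g) (hfan : g.fanIn ≤ 2) :
    pairEval (gateCoef (m := m) i g) (fun v => value P j v) = P.gateVal i := by
  have hi : i < P.size := (List.getElem?_eq_some_iff.1 hg).1
  have hone : oneCode < m := oneCode_lt hm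
  cases g with
  | sum args =>
    rw [P.gateVal_of_sum hg, gateCoef, pairEval_list_sum, List.map_map]
    congr 1
    refine List.map_congr_left fun a _ => ?_
    simp only [Function.comp_apply]
    exact pairEval_opTable hm hij hi.le a.1 a.2
  | prod args =>
    rw [P.gateVal_of_prod hg, gateCoef]
    have hlen : args.length ≤ 2 := by
      simpa [ArithCircuit.Gate.fanIn, ArithCircuit.Gate.args] using hfan
    rcases args with _ | ⟨o₁, _ | ⟨o₂, _ | ⟨o₃, l⟩⟩⟩
    · rw [prodCoef, List.map_nil, List.prod_nil, pairEval_pairInd _ hone hone, value_oneCode,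
        mul_one]
    · rw [prodCoef, List.map_cons, List.map_nil, List.prod_cons, List.prod_nil, mul_one,
        pairEval_smul, pairEval_pairInd _ (opCode_lt hm hi.le o₁) hone, value_oneCode, mul_one,
        opCoef_mul_value hij hi.le]
    · rw [prodCoef, List.map_cons, List.map_cons, List.map_nil, List.prod_cons, List.prod_cons,
        List.prod_nil, mul_one, pairEval_smul,
        pairEval_pairInd _ (opCode_lt hm hi.le o₁) (opCode_lt hm hi.le o₂), map_mul,
        ← opCoef_mul_value hij hi.le o₁, ← opCoef_mul_value hij hi.le o₂]
      ring
    · simp at hlen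

variable {k : ℕ}

/-- **The embedding is correct, level by level**: under the specialisation `subst P k m`, the
node `u` at height `j ≤ k - 1` of the generic circuit computes its intended value (the constant
`1`, a variable, the value of a gate already computed, or `0`).
[cite: MulmuleySohoniSIAM2001, §6 (AV p.28, all.txt L2037–2041)] -/
theorem aeval_subst_nodeVal (h2 : P.IsFanInTwo) (hm : 1 + Fintype.card σ + P.size ≤ m) :
    ∀ (j : ℕ), j ≤ k - 1 → ∀ u : Fin m,
      aeval (subst P k m) (nodeVal F k m j u) = value P j u
  | 0, _, u => by
    cases hr : role σ P.size (u : ℕ) <;> simp [subst, inputSubst, value, hr]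
  | j + 1, hj, u => by
    have hj' : j < k - 1 := by omega
    have ih : ∀ v : Fin m, aeval (subst P k m) (nodeVal F k m j v) = value P j v :=
      aeval_subst_nodeVal h2 hm j hj'.le
    rw [nodeVal_succ F k m hj']
    simp only [map_sum, map_mul, aeval_X, ih]
    change pairEval (innerCoef P j (u : ℕ)) (fun v => value P j v) = value P (j + 1) u
    have hone : oneCode < m := oneCode_lt hm
    cases hr : role σ P.size (u : ℕ) with
    | one =>
      have hR : value P (j + 1) (u : ℕ) = 1 := by simp [value, hr]
      simp only [innerCoef, hr, hR]
      rw [pairEval_pairInd _ hone hone, value_oneCode, mul_one]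
    | var x =>
      have hR : value P (j + 1) (u : ℕ) = X x := by simp [value, hr]
      simp only [innerCoef, hr, hR]
      rw [pairEval_pairInd _ (varCode_lt hm x) hone, value_oneCode, mul_one, value_varCode]
    | gate t =>
      have hts : t < P.size := lt_of_role_eq_gate hr
      have hR : value P (j + 1) (u : ℕ) = if t + 1 ≤ j + 1 then P.gateVal t else 0 := by
        simp only [value, hr]
      simp only [innerCoef, hr, hR]
      by_cases htj : t < j
      · have h1 : t + 1 ≤ j + 1 := by omega
        have h1' : t + 1 ≤ j := by omega
        rw [if_pos htj, if_pos h1, pairEval_pairInd _ (gateCode_lt hm hts) hone, value_oneCode,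
          mul_one, value_gateCode hts, if_pos h1']
      · by_cases htj' : t = j
        · subst htj'
          rw [if_neg htj, if_pos rfl, if_pos le_rfl]
          obtain ⟨g, hg⟩ : ∃ g, P.gates[t]? = some g := ⟨P.gates[t], List.getElem?_eq_getElem hts⟩
          rw [hg]
          exact pairEval_gateCoef hm le_rfl hg (h2 g (List.mem_of_getElem? hg))
        · have h1 : ¬ t + 1 ≤ j + 1 := by omega
          rw [if_neg htj, if_neg htj', if_neg h1, pairEval_zero]
    | none =>
      have hR : value P (j + 1) (u : ℕ) = 0 := by simp [value, hr]
      simp only [innerCoef, hr, hR]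
      rw [pairEval_zero]

/-- **The root computes `P`**: under `subst P k m`, with `k ≥ s + 1` (so that every gate has been
computed by height `k - 1`) and `m ≥ 1 + #σ + s`, the generic circuit form specialises to the
polynomial computed by `P`. [cite: MulmuleySohoniSIAM2001, §6 (AV p.28, all.txt L2037–2041)] -/
theorem aeval_subst_genericCircuitForm (h2 : P.IsFanInTwo) (hk : P.size + 1 ≤ k)
    (hm : 1 + Fintype.card σ + P.size ≤ m) :
    aeval (subst P k m) (genericCircuitForm F k m) = P.eval := by
  rw [genericCircuitForm]
  simp only [map_sum, map_mul, aeval_X, aeval_subst_nodeVal h2 hm (k - 1) le_rfl]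
  change pairEval (rootCoef P) (fun v => value P (k - 1) v) = P.eval
  rw [rootCoef, pairEval_smul, pairEval_pairInd _ (opCode_lt hm le_rfl P.output) (oneCode_lt hm),
    value_oneCode, mul_one, opCoef_mul_value (by omega) le_rfl, ArithCircuit.eval_eq_opVal_output]

/-- **Universality of the generic circuit (GCT I §6, AV p.28 L2037–2041)**: "Any arithmetic
circuit of size `r` can be obtained from the generic circuit of depth `k ≤ r` and width `m ≤ r`
by specializing the indeterminates `y^u_{v,w}` to some constants and the indeterminates `y_u`s at
the input level to the input parameters or constants. Hence `H(Y)` is complete for the class of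
polynomials with small circuits." Typed in the tree's model: a fan-in-two circuit `P` with `s`
gates on the finite variable type `σ` computes a PROJECTION (`IsProjection`, Valiant) of `H(Y)`
of every depth `k ≥ s + 1` and width `m ≥ #σ + s + 1` (print: `k, m ≤ r` with `r` counting the
input nodes too; see the module docstring for the accounting). Over every commutative semiring.
[cite: MulmuleySohoniSIAM2001, §6 (AV p.28, all.txt L2037–2041)] -/
theorem isProjection_eval (h2 : P.IsFanInTwo) (hk : P.size + 1 ≤ k)
    (hm : Fintype.card σ + P.size + 1 ≤ m) :
    IsProjection P.eval (genericCircuitForm F k m) :=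
  ⟨subst P k m, subst_isVarOrConst P k m,
    (aeval_subst_genericCircuitForm h2 hk (by omega)).symm⟩

end Embedding

end MS2001GenericCircuit

/-- **`H(Y)` is complete for polynomials of small circuit complexity** (GCT I §6, AV p.28
L2037–2041), in the currency of the tree's `complexity` (least size of a fan-in-two circuit,
Bürgisser's `L(f)` up to a factor `≤ 3`): if `complexity f ≤ r` then `f` is a projection of the
generic circuit form of every depth `k ≥ r + 1` and width `m ≥ #σ + r + 1`.
[cite: MulmuleySohoniSIAM2001, §6 (AV p.28, all.txt L2037–2041)] -/
theorem isProjection_genericCircuitForm_of_complexity_le {F : Type u} [CommSemiring F]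
    {σ : Type v} [Fintype σ] {f : MvPolynomial σ F} {r k m : ℕ}
    (hr : complexity f ≤ r) (hk : r + 1 ≤ k) (hm : Fintype.card σ + r + 1 ≤ m) :
    IsProjection f (genericCircuitForm F k m) := by
  obtain ⟨P, h2, hP, hsize⟩ := ArithCircuit.exists_computes_size_eq_complexity f
  have hs : P.size ≤ r := hsize ▸ hr
  rw [← show P.eval = f from hP]
  exact MS2001GenericCircuit.isProjection_eval h2 (by omega) (by omega)

/-! ## §4. Proposition 6.1 -/

/-- **GCT I, Prop. 6.1** (Mulmuley–Sohoni 2001, AV p.28, all.txt L2057–2062): "If `f(X)` has an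
arithmetic circuit of size `r` then `f^φ(Y)` lies in the (projective) Zariski-closure `Δ[H(Y)]`
of the `G`-orbit of `H(Y)` in `P(V)`, where `l = O(r²)`. *Proof:* The proof is similar to that of
Proposition 4.1. The role of determinant in that proof is now played by `H(Y)`, which is complete
for the class of functions with small circuits." Here `H(Y) = genericCircuitForm F k m` is the
generic circuit form of depth `k` and width `m`, `V = Sym^D(Y)` with `D = 2^{k+1} - 1 = deg H(Y)`,
`f` a form of degree `d ≤ D` on the finite variable type `σ` with `complexity f ≤ r` (a fan-in-two
circuit with `≤ r` gates), and `f^φ(Y) = X_y^{D-d} · f(X_ι)` for a placement `ι : σ → Y` of the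
variables and a homogenising variable `y` ("identify `X` with some of the input variables in `Y`
and use some remaining variable as a homogenizing parameter"; typed for EVERY `ι` and `y`).
CONSTANTS: depth `k ≥ r + 1`, width `m ≥ #σ + r + 1` (print: `k, m ≤ r` with `r` counting input
nodes; module docstring), `l = m + m² + (k-1) m³` (print: `l = O(r²)`; module docstring). PROOF as
printed: `f` is a projection of `H(Y)` (`isProjection_genericCircuitForm_of_complexity_le`), the
padded projection is a linear-substitution instance of `H(Y)`
(`X_pow_mul_rename_mem_endOrbit_of_isProjection`, "as in Proposition 4.1"), and
`End · H ⊆ Δ[H]` (`endOrbit_subset_orbitClosure_holds`, density of `GL_l`). Over every infinite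
field (print: `F` algebraically closed).
[cite: MulmuleySohoniSIAM2001, Prop. 6.1 (AV p.28, all.txt L2057)] -/
theorem MS2001_prop_6_1 {F : Type u} [Field F] [Infinite F] {σ : Type v} [Fintype σ]
    {f : MvPolynomial σ F} {d r k m : ℕ} (hf : f.IsHomogeneous d)
    (hr : complexity f ≤ r) (hk : r + 1 ≤ k) (hm : Fintype.card σ + r + 1 ≤ m)
    (hd : d ≤ 2 ^ (k + 1) - 1) (ι : σ → MS2001GenericCircuit.Var k m)
    (y : MS2001GenericCircuit.Var k m) :
    X y ^ (2 ^ (k + 1) - 1 - d) * rename ι f ∈ orbitClosure (genericCircuitForm F k m) :=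
  endOrbit_subset_orbitClosure_holds _
    (X_pow_mul_rename_mem_endOrbit_of_isProjection
      (isHomogeneous_genericCircuitForm F k m (by omega)) hf hd
      (isProjection_genericCircuitForm_of_complexity_le hr hk hm) ι y)

/-- **Prop. 6.1 for a given circuit** (same statement with the circuit `P` explicit: `s = P.size`
gates, fan-in two, computing the form `P.eval` of degree `d`; depth `k ≥ s + 1`, width
`m ≥ #σ + s + 1`). [cite: MulmuleySohoniSIAM2001, Prop. 6.1 (AV p.28, all.txt L2057)] -/
theorem MS2001_prop_6_1_of_circuit {F : Type u} [Field F] [Infinite F] {σ : Type v} [Fintype σ]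
    {P : ArithCircuit F σ} (h2 : P.IsFanInTwo) {d k m : ℕ}
    (hf : P.eval.IsHomogeneous d) (hk : P.size + 1 ≤ k) (hm : Fintype.card σ + P.size + 1 ≤ m)
    (hd : d ≤ 2 ^ (k + 1) - 1) (ι : σ → MS2001GenericCircuit.Var k m)
    (y : MS2001GenericCircuit.Var k m) :
    X y ^ (2 ^ (k + 1) - 1 - d) * rename ι P.eval ∈ orbitClosure (genericCircuitForm F k m) :=
  endOrbit_subset_orbitClosure_holds _
    (X_pow_mul_rename_mem_endOrbit_of_isProjection
      (isHomogeneous_genericCircuitForm F k m (by omega)) hf hd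
      (MS2001GenericCircuit.isProjection_eval h2 hk hm) ι y)

end Literature.Computability.AlgebraicComplexity
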